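import Literature.Geometry.Lorentzian.MinimalGraphMaximumPrincipleProofs
import HarnessLib

/-!
# The maximum principle for minimal graphs from the tangency-principle ingredients
(family `gr`, in support of **gr.S09** `riemannian_penrose_inequality_connected_smooth` of
`MassInequalities.lean`; namespace `Literature.Geometry.Lorentzian`)

Library fit. `MinimalSurfaceBarrier.lean` reduces the connected-horizon Riemannian Penrose
inequality to Huisken–Ilmanen's two facts and the barrier principle
`minimalSurface_barrierPrinciple`; `MinimalGraphMaximumPrinciple.lean` splits the latter into
`touchingSurface_locallyGraph` (step (1): local graph representation at a touching point —
**discharged**, `touchingSurface_locallyGraph_holds`; also in general dimension as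
`exists_graph_of_touching_below`, `TouchingHypersurfaces.lean`) and the live named fact
`minimalGraph_strongMaximumPrinciple` (Andersson–Galloway–Howard 1998, Thm. 3.10 for two minimal
graphs `u₁ ≤ u₀` over a preconnected base `V` of a coordinate cylinder: `u₀ ≡ u₁`). This file
reduces **that** fact to the two classical analytic inputs of every tangency principle
(Fontenele–Silva, Illinois J. Math. 45 (2001): (2) the mean curvature of a chart-graph is an
elliptic expression `Φ(Λ(u))` in the graph function, Lemma 3.1 and Props. 3.2, 3.4; (3)
Alexandrov's maximum principle for `C¹` elliptic `Φ`, §2 — linearise and apply E. Hopf's strong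
maximum principle), taken as *explicit hypotheses* (D-0026: a proof unit mints no named facts):

* `Jet n`, `jet2 f x` (`Λ(f)(x) = (f_ij, f_i, f, x)`, (2.2)), `IsEllipticAt Φ p` ((2.1)),
  `chartJetSet ψ T` (jets based in the chart) — real definitions;
* `MinimalGraphOperator h ψ T` — hypothesis structure, the datum of step (2) for the chart
  `T ∘ ψ` of the Riemannian `3`-manifold `(X, h)`: `Φ` on jets, `C¹` and elliptic on
  `chartJetSet ψ T`, vanishing on the jets of every `C²` function whose graph over an open
  `V ⊆ ℝ²` is exactly an open piece of a smoothly embedded minimal surface;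
* `HasTangencyMaximumPrinciple Φ Γ` — predicate: `Φ` satisfies the conclusion of Alexandrov's
  maximum principle on `Γ` (step (3), as printed in Fontenele–Silva, §2);
* `minimalGraph_strongMaximumPrinciple_of_graphOperator` — **theorem**: if every chart of every
  Riemannian `3`-manifold carries a `MinimalGraphOperator` with the tangency maximum principle on
  `chartJetSet`, then `minimalGraph_strongMaximumPrinciple` holds (`Wᵢ := fᵢ⁻¹(C)` exhibit the
  two surfaces over `V` as the graphs of `u₀`, `u₁`, so `Φ(Λu₀) = Φ(Λu₁) = 0`; the segment jets
  are based in the cylinder `⊆ ψ.target`; step (3) with `f = u₁ ≤ g = u₀` gives local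
  coincidence, and `{u₁ = u₀}` is clopen in the preconnected `V`);
* `minimalSurface_barrierPrinciple_of_graphOperator`,
  `riemannian_penrose_inequality_connected_smooth_of_graphOperator` — one-liners through the
  existing chain (`minimalSurface_barrierPrinciple_of_graph`,
  `riemannian_penrose_inequality_connected_smooth_of_graph`, `touchingSurface_locallyGraph_holds`).

Not here: the two inputs as theorems — `Nonempty (MinimalGraphOperator h ψ T)` for every chart
(Fontenele–Silva, Props. 3.2, 3.4 with the chart inverse in place of `exp_p`; their proofs use of
`(x, z) ↦ exp_p(x + zη₀)` only that it is a local diffeomorphism — a coordinate identity for the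
mean curvature of `Hypersurface.lean`) and `IsOpen Γ → ContDiffOn ℝ 1 Φ Γ →
HasTangencyMaximumPrinciple Φ Γ` (Alexandrov; from E. Hopf's strong maximum principle, Fraenkel
2000, Thm. 2.13 with Remark 2.16, whose pointwise ingredients are being proved under
`Literature/Analysis/PDE/`, `HopfLemmas.lean`, `HopfBarrier.lean`); with them
`minimalGraph_strongMaximumPrinciple_holds` is a corollary of the theorem here.

## Mathlib

Used: `fderiv`, `ContDiffOn`, `EuclideanSpace.single`, `Set.prod`, `Set.MapsTo`,
`IsPreconnected.subset_left_of_subset_union`, `ContinuousOn.isOpen_inter_preimage`. Mathlib has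
no mean curvature and no maximum principle for elliptic operators (`lean search`: no prior
jet / ellipticity / tangency notions in Mathlib or `Literature`).

## References

* F. Fontenele, S. L. Silva, *A tangency principle and applications*, Illinois J. Math. 45 (2001)
  213–228: §2 ((2.1), (2.2), Maximum Principle), §3 (Lemma 3.1, Props. 3.2, 3.4), §4 (proof of
  Thm. 1.1).
* L. Andersson, G. J. Galloway, R. Howard, Comm. Pure Appl. Math. 51 (1998) 581–624, Thm. 3.10.
* L. E. Fraenkel, *An Introduction to Maximum Principles and Symmetry in Elliptic Problems*,
  Cambridge Univ. Press 2000: Def. 2.3, Thm. 2.13, Remark 2.16.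
* J.-H. Eschenburg, Manuscripta Math. 64 (1989) 55–75, Thm. 1.
-/

noncomputable section

open Bundle Set Manifold TopologicalSpace Filter Function
open scoped ContDiff Topology Manifold

namespace Literature.Geometry.Lorentzian

open PseudoRiemannianMetric

/-! ### Second-order jets and elliptic functions -/

section Jets

/-- The **jet space** `ℝ^d` of Fontenele–Silva, Illinois J. Math. 45 (2001), §2, holding the
arguments `(r_ij, r_i, z, x)` of a second-order operator `Φ` on functions of `n` variables: the
Hessian slot `r : Fin n → Fin n → ℝ` (all `n²` entries; Fontenele–Silva keep the `n(n+1)/2` entries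
`i ≤ j` of a symmetric matrix — a function of those is a function of all entries through the upper
triangle, and the jets of `C²` functions are symmetric), the gradient slot `q : Fin n → ℝ`, the value
`z ∈ ℝ` and the point `x ∈ ℝⁿ`. [cite: FonteneleSilva2001, §2 (2.2)] -/
abbrev Jet (n : ℕ) : Type :=
  (Fin n → Fin n → ℝ) × (Fin n → ℝ) × ℝ × EuclideanSpace ℝ (Fin n)

variable {n : ℕ}

/-- The **second-order jet** `Λ(f)(x) = (f_ij(x), f_i(x), f(x), x)` of `f : ℝⁿ → ℝ` at `x`
(Fontenele–Silva 2001, (2.2)): `f_i = ∂f/∂xᵢ`, `f_ij = ∂²f/∂xᵢ∂xⱼ`, the partial derivatives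
being Fréchet derivatives along the standard basis vectors `eᵢ = EuclideanSpace.single i 1`
(`f_ij(x) = ∂ᵢ(∂ⱼf)(x)`). [cite: FonteneleSilva2001, §2 (2.2)] -/
def jet2 (f : EuclideanSpace ℝ (Fin n) → ℝ) (x : EuclideanSpace ℝ (Fin n)) : Jet n :=
  (fun i j ↦ fderiv ℝ (fun y ↦ fderiv ℝ f y (EuclideanSpace.single j (1 : ℝ))) x
      (EuclideanSpace.single i (1 : ℝ)),
    fun i ↦ fderiv ℝ f x (EuclideanSpace.single i (1 : ℝ)), f x, x)

/-- `Φ : ℝ^d → ℝ` is **elliptic at the jet `p`** (Fontenele–Silva, Illinois J. Math. 45 (2001),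
§2, (2.1)): `∑_{i ≤ j} ∂Φ/∂r_ij (p) ξ_i ξ_j > 0` for every `ξ ≠ 0` — for `Φ` a function of the
upper-triangular entries this is the derivative of `Φ` at `p` in the direction of the symmetric
jet `((ξ_i ξ_j)_{ij}, 0, 0, 0)`, which is the form used here. [cite: FonteneleSilva2001, §2 (2.1)] -/
def IsEllipticAt (Φ : Jet n → ℝ) (p : Jet n) : Prop :=
  ∀ ξ : Fin n → ℝ, ξ ≠ 0 → 0 < fderiv ℝ Φ p (fun i j ↦ ξ i * ξ j, 0, 0, 0)

end Jets

/-! ### The tangency maximum principle as a property of an operator -/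

/-- `Φ` **has the tangency maximum principle on `Γ`** (predicate): the conclusion of Alexandrov's
maximum principle as printed in Fontenele–Silva, Illinois J. Math. 45 (2001), §2 — *for
`C²`-functions `f, g` on an open `U ⊆ ℝⁿ` such that `Φ` is elliptic with respect to the functions
`(1 - t) f + t g`, `t ∈ [0, 1]` (their jets lie in `Γ` and `Φ` is elliptic there), (2.3)
`Φ(Λ(f)) ≥ Φ(Λ(g))` on `U` and `f ≤ g` on `U`: `f < g` on `U` unless `f` and `g` coincide in a
neighbourhood of any point `x₀ ∈ U` with `f(x₀) = g(x₀)`* — holds for `Φ`, in the operative form: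
at every touching point `f = g` nearby. Alexandrov's theorem (Fontenele–Silva, §2, after
A. D. Alexandrov 1962; proof: linearise `Φ(Λf) - Φ(Λg) = L(f - g) ≥ 0` and apply E. Hopf's strong
maximum principle, Fraenkel 2000, Thm. 2.13 with Remark 2.16) says that every `Φ` of class `C¹`
on an open `Γ` has this property; it is not vendored here (module docstring).
[cite: FonteneleSilva2001, §2 Maximum Principle] -/
def HasTangencyMaximumPrinciple {n : ℕ} (Φ : Jet n → ℝ) (Γ : Set (Jet n)) : Prop :=
  ∀ (U : Set (EuclideanSpace ℝ (Fin n))) (f g : EuclideanSpace ℝ (Fin n) → ℝ),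
    IsOpen U → ContDiffOn ℝ 2 f U → ContDiffOn ℝ 2 g U →
    (∀ t ∈ Icc (0 : ℝ) 1, ∀ x ∈ U,
      jet2 ((1 - t) • f + t • g) x ∈ Γ ∧ IsEllipticAt Φ (jet2 ((1 - t) • f + t • g) x)) →
    (∀ x ∈ U, Φ (jet2 g x) ≤ Φ (jet2 f x)) → (∀ x ∈ U, f x ≤ g x) →
    ∀ x₀ ∈ U, f x₀ = g x₀ → ∀ᶠ x in 𝓝 x₀, f x = g x

/-! ### The minimal-surface equation for graphs in a chart -/

section Chart

variable {X : Type*} [TopologicalSpace X]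

/-- The jets `(r, q, z, x)` whose base point `(x, z)` lies in the straightened chart:
`T⁻¹ (x, z) ∈ ψ.target` (the open set `ℝ^{n(n+1)/2 + n} × 𝒩` of Fontenele–Silva 2001, §3, for the
chart `T ∘ ψ` in place of their exponential chart). [cite: FonteneleSilva2001, §3 (domain of Φ_r)] -/
def chartJetSet (ψ : OpenPartialHomeomorph X E3) (T : E3 ≃L[ℝ] EuclideanSpace ℝ (Fin 2) × ℝ) :
    Set (Jet 2) :=
  {p | T.symm (p.2.2.2, p.2.2.1) ∈ ψ.target}

/-- Unfolding lemma: `Λ(F)(x)` lies in `chartJetSet ψ T` iff `T⁻¹ (x, F x) ∈ ψ.target`.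
[folklore] -/
lemma jet2_mem_chartJetSet {ψ : OpenPartialHomeomorph X E3}
    {T : E3 ≃L[ℝ] EuclideanSpace ℝ (Fin 2) × ℝ} {F : EuclideanSpace ℝ (Fin 2) → ℝ}
    {x : EuclideanSpace ℝ (Fin 2)} :
    jet2 F x ∈ chartJetSet ψ T ↔ T.symm (x, F x) ∈ ψ.target :=
  Iff.rfl

/-- The set of such jets is open. [folklore] -/
lemma isOpen_chartJetSet (ψ : OpenPartialHomeomorph X E3)
    (T : E3 ≃L[ℝ] EuclideanSpace ℝ (Fin 2) × ℝ) : IsOpen (chartJetSet ψ T) :=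
  ψ.open_target.preimage (T.symm.continuous.comp (by fun_prop))

end Chart

/-- Hypothesis structure: **the minimal-surface operator for graphs in the chart `T ∘ ψ`** of the
Riemannian `3`-manifold `(X, h)` — the datum of Fontenele–Silva, Illinois J. Math. 45 (2001), §3,
Lemma 3.1 and Props. 3.2, 3.4 (case `r = 1`): *parametrising a hypersurface of `N^{n+1}` near `p`
as a graph `ϕ(x) = E(x, μ(x))`, its mean curvature is `H₁(x) = Φ₁(Λ(μ)(x))` for a function `Φ₁`
on the open set of jets based in the chart, elliptic at every such jet* (Prop. 3.4:
`∑ ∂Φ₁/∂r_kl ξ_k ξ_l = (ω/n) ξᵀFξ > 0`). There `E(x, z) = exp_p(x + zη₀)`; the printed proofs use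
only that `E` is a local diffeomorphism, and the structure records the same datum for
`E = ψ⁻¹ ∘ T⁻¹`: a function `Φ` of jets, `C¹` and elliptic on `chartJetSet ψ T`, such that
`Φ(Λ(u)(x)) = 0` on `V` whenever an open piece `f '' W₀` of a smoothly embedded minimal surface
(`H = 0` for a smooth unit normal, `IsMaximalSlice`) is exactly the graph
`{height = u (horizontal)}` of a `C²` function `u` over the open `V ⊆ ℝ²` (minimality is
independent of the parametrisation and of the sign of the normal). Bracketed instance binders as in
`minimalSurface_barrierPrinciple`. [cite: FonteneleSilva2001, Lemma 3.1, Prop. 3.2 and Prop. 3.4 (r = 1)] -/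
structure MinimalGraphOperator {X : Type} [TopologicalSpace X] [ChartedSpace E3 X]
    [IsManifold (𝓡 3) ∞ X]
    (h : ContMDiffRiemannianMetric (𝓡 3) ∞ E3 (TangentSpace (𝓡 3) : X → Type _))
    [(ofRiemannian h).HasLeviCivita]
    (ψ : OpenPartialHomeomorph X E3) (T : E3 ≃L[ℝ] EuclideanSpace ℝ (Fin 2) × ℝ) where
  /-- The operator `Φ(r_ij, r_i, z, x)` on jets. -/
  Φ : Jet 2 → ℝ
  /-- `Φ` is `C¹` on the jets based in the chart. -/
  contDiffOn : ContDiffOn ℝ 1 Φ (chartJetSet ψ T)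
  /-- `Φ` is elliptic at every jet based in the chart. -/
  isEllipticAt : ∀ p ∈ chartJetSet ψ T, IsEllipticAt Φ p
  /-- Graphs of minimal surfaces solve `Φ(Λ(u)) = 0`. -/
  eq_zero : ∀ (S : Type) [TopologicalSpace S] [ChartedSpace (EuclideanSpace ℝ (Fin 2)) S]
    [IsManifold (𝓡 2) ∞ S] [T2Space S]
    (f : S → X) (ν : NormalField (𝓡 3) f) (hpb : contMDiff_pullbackBilin (𝓡 3) X (𝓡 2) S ∞)
    (hf : (ofRiemannian h).IsSpacelikeImmersion (𝓡 2) f),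
    Manifold.IsSmoothEmbedding (𝓡 2) (𝓡 3) ∞ f → (ofRiemannian h).IsUnitNormal (𝓡 2) f ν 1 →
    ContMDiff (𝓡 2) (𝓡 3).tangent ∞
      (fun y ↦ (TotalSpace.mk' E3 (f y) (ν y) : TangentBundle (𝓡 3) X)) →
    (ofRiemannian h).IsMaximalSlice f hpb hf ν →
    ∀ (W₀ : Set S) (V : Set (EuclideanSpace ℝ (Fin 2))) (u : EuclideanSpace ℝ (Fin 2) → ℝ),
      IsOpen W₀ → IsOpen V → ContDiffOn ℝ 2 u V → (∀ y ∈ W₀, f y ∈ ψ.source) →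
      (fun y ↦ (T (ψ (f y))).1) '' W₀ = V →
      (∀ y ∈ W₀, (T (ψ (f y))).2 = u (T (ψ (f y))).1) →
      ∀ x ∈ V, Φ (jet2 u x) = 0

/-! ### AGH Thm. 3.10 for minimal graphs from steps (2)–(3) -/

/-- **The geometric maximum principle for minimal graphs, assembled from steps (2)–(3) of the
tangency principle.** If every chart `T ∘ ψ` (`ψ` in the maximal `C^∞` atlas) of every
Riemannian `3`-manifold carries a minimal-graph operator (`MinimalGraphOperator`, step (2)) having
the tangency maximum principle on the jets based in the chart (step (3)), then
`minimalGraph_strongMaximumPrinciple` (Andersson–Galloway–Howard 1998, Thm. 3.10 for minimal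
graphs) holds. Proof (Fontenele–Silva 2001, proof of Thm. 1.1, for the two graphs of the
cylinder): `Wᵢ := fᵢ⁻¹(C)`, `C` the coordinate cylinder over `V`, is open and `fᵢ(Wᵢ) = Σᵢ ∩ C`
is exactly the graph of `uᵢ` over `V` (the graph point over `y ∈ V` lies in the cylinder, hence
in `ψ.target`, and is a point of `Σᵢ` by the graph hypothesis), so `Φ(Λ(uᵢ)) = 0` on `V`
(`eq_zero`); the jets of `(1 - t) u₁ + t u₀` are based at `(y, (1 - t) u₁ y + t u₀ y)`, inside the
cylinder, where `Φ` is elliptic; the tangency maximum principle with `f = u₁ ≤ g = u₀` makes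
`{y ∈ V | u₁ y = u₀ y}` open; it is closed in `V` and nonempty, so it is the preconnected `V`.
[cite: FonteneleSilva2001, proof of Thm. 1.1] [cite: AnderssonGallowayHoward1998, Thm. 3.10] -/
theorem minimalGraph_strongMaximumPrinciple_of_graphOperator
    (H : ∀ (X : Type) [TopologicalSpace X] [ChartedSpace E3 X] [IsManifold (𝓡 3) ∞ X] [T2Space X]
      [SecondCountableTopology X]
      (h : ContMDiffRiemannianMetric (𝓡 3) ∞ E3 (TangentSpace (𝓡 3) : X → Type _))
      [(ofRiemannian h).HasLeviCivita]
      (ψ : OpenPartialHomeomorph X E3) (T : E3 ≃L[ℝ] EuclideanSpace ℝ (Fin 2) × ℝ),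
      ψ ∈ IsManifold.maximalAtlas (𝓡 3) ∞ X →
      ∃ G : MinimalGraphOperator h ψ T, HasTangencyMaximumPrinciple G.Φ (chartJetSet ψ T)) :
    minimalGraph_strongMaximumPrinciple := by
  intro X _ _ _ _ _ h _ S₀ _ _ _ _ f₀ ν₀ hpb₀ hf₀ hemb₀ hunit₀ hν₀ hmin₀ S₁ _ _ _ _ f₁ ν₁ hpb₁ hf₁
    hemb₁ hunit₁ hν₁ hmin₁ ψ T V r u₀ u₁ hψ hV hVconn hr hcyl hu₀ hu₁ hu₀V hu₁V hgraph₀ hgraph₁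
    hle htouch
  obtain ⟨G, hMP⟩ := H X h ψ T hψ
  set C : Set X := {x | x ∈ ψ.source ∧ T (ψ x) ∈ V ×ˢ Ioo (-r) r} with hC
  have hCopen : IsOpen C :=
    (T.continuous.comp_continuousOn ψ.continuousOn).isOpen_inter_preimage ψ.open_source
      (hV.prod isOpen_Ioo)
  -- a graph point over `V` with height in `(-r, r)` is a point `x ∈ C` with `T (ψ x) = (y, s)`
  have hpt : ∀ y ∈ V, ∀ s ∈ Ioo (-r) r, T.symm (y, s) ∈ ψ.target ∧
      ψ.symm (T.symm (y, s)) ∈ C ∧ T (ψ (ψ.symm (T.symm (y, s)))) = (y, s) := by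
    intro y hy s hs
    have hq : T.symm (y, s) ∈ ψ.target := hcyl (mem_image_of_mem _ (mk_mem_prod hy hs))
    have hT : T (ψ (ψ.symm (T.symm (y, s)))) = (y, s) := by
      rw [ψ.right_inv hq, ContinuousLinearEquiv.apply_symm_apply]
    exact ⟨hq, ⟨ψ.map_target hq, by rw [hT]; exact mk_mem_prod hy hs⟩, hT⟩
  -- **step (2)** for each surface: `Φ(Λ(uᵢ)) = 0` on `V`
  have key : ∀ (S : Type) [TopologicalSpace S] [ChartedSpace (EuclideanSpace ℝ (Fin 2)) S]
      [IsManifold (𝓡 2) ∞ S] [T2Space S] (f : S → X) (ν : NormalField (𝓡 3) f)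
      (hpb : contMDiff_pullbackBilin (𝓡 3) X (𝓡 2) S ∞)
      (hf : (ofRiemannian h).IsSpacelikeImmersion (𝓡 2) f),
      Manifold.IsSmoothEmbedding (𝓡 2) (𝓡 3) ∞ f → (ofRiemannian h).IsUnitNormal (𝓡 2) f ν 1 →
      ContMDiff (𝓡 2) (𝓡 3).tangent ∞
        (fun y ↦ (TotalSpace.mk' E3 (f y) (ν y) : TangentBundle (𝓡 3) X)) →
      (ofRiemannian h).IsMaximalSlice f hpb hf ν →
      ∀ u : EuclideanSpace ℝ (Fin 2) → ℝ, ContDiffOn ℝ ∞ u V → MapsTo u V (Ioo (-r) r) →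
      range f ∩ C = {x | (x ∈ ψ.source ∧ T (ψ x) ∈ V ×ˢ Ioo (-r) r) ∧
        (T (ψ x)).2 = u (T (ψ x)).1} →
      ∀ y ∈ V, G.Φ (jet2 u y) = 0 := by
    intro S _ _ _ _ f ν hpb hf hemb hunit hν hmin u hu huV hgraph
    have hfc : Continuous f := hemb.isEmbedding.continuous
    set W : Set S := f ⁻¹' C with hW
    have hWgraph : ∀ w ∈ W, (T (ψ (f w))).2 = u (T (ψ (f w))).1 := by
      intro w hw
      have h' : f w ∈ range f ∩ C := ⟨⟨w, rfl⟩, hw⟩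
      rw [hgraph] at h'
      exact h'.2
    refine G.eq_zero S f ν hpb hf hemb hunit hν hmin W V u (hCopen.preimage hfc) hV
      (hu.of_le (by norm_cast)) (fun w hw ↦ hw.1) ?_ hWgraph
    apply Subset.antisymm
    · rintro _ ⟨w, hw, rfl⟩
      exact hw.2.1
    · intro y hy
      obtain ⟨-, hxC, hTx⟩ := hpt y hy (u y) (huV hy)
      have hx : ψ.symm (T.symm (y, u y)) ∈ range f ∩ C := by
        rw [hgraph]
        exact ⟨hxC, by rw [hTx]⟩
      obtain ⟨⟨w, hw⟩, -⟩ := hx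
      refine ⟨w, show f w ∈ C by rw [hw]; exact hxC, ?_⟩
      show (T (ψ (f w))).1 = y
      rw [hw, hTx]
  have hΦ₀ := key S₀ f₀ ν₀ hpb₀ hf₀ hemb₀ hunit₀ hν₀ hmin₀ u₀ hu₀ hu₀V hgraph₀
  have hΦ₁ := key S₁ f₁ ν₁ hpb₁ hf₁ hemb₁ hunit₁ hν₁ hmin₁ u₁ hu₁ hu₁V hgraph₁
  -- **step (3)**: the tangency maximum principle with `f = u₁ ≤ g = u₀`
  have hseg : ∀ t ∈ Icc (0 : ℝ) 1, ∀ y ∈ V,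
      jet2 ((1 - t) • u₁ + t • u₀) y ∈ chartJetSet ψ T ∧
        IsEllipticAt G.Φ (jet2 ((1 - t) • u₁ + t • u₀) y) := by
    intro t ht y hy
    have hmem : jet2 ((1 - t) • u₁ + t • u₀) y ∈ chartJetSet ψ T := by
      rw [jet2_mem_chartJetSet]
      have hval : ((1 - t) • u₁ + t • u₀) y = (1 - t) * u₁ y + t * u₀ y := by simp
      rw [hval]
      have hs : (1 - t) * u₁ y + t * u₀ y ∈ Ioo (-r) r := by
        have := convex_Ioo (-r) r (hu₁V hy) (hu₀V hy) (show (0 : ℝ) ≤ 1 - t by linarith [ht.2])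
          (show (0 : ℝ) ≤ t from ht.1) (show (1 - t) + t = 1 by ring)
        simpa [smul_eq_mul] using this
      exact (hpt y hy _ hs).1
    exact ⟨hmem, G.isEllipticAt _ hmem⟩
  have hloc : ∀ y₀ ∈ V, u₁ y₀ = u₀ y₀ → ∀ᶠ y in 𝓝 y₀, u₁ y = u₀ y :=
    hMP V u₁ u₀ hV (hu₁.of_le (by norm_cast)) (hu₀.of_le (by norm_cast)) hseg
      (fun y hy ↦ (hΦ₀ y hy).le.trans (hΦ₁ y hy).ge) hle
  -- the coincidence set is clopen in the preconnected `V`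
  set A : Set (EuclideanSpace ℝ (Fin 2)) := {y | y ∈ V ∧ u₁ y = u₀ y} with hA
  set B : Set (EuclideanSpace ℝ (Fin 2)) := V ∩ (fun y ↦ u₀ y - u₁ y) ⁻¹' Ioi 0 with hB
  have hAopen : IsOpen A := by
    rw [isOpen_iff_mem_nhds]
    rintro y₀ ⟨hy₀, hy₀eq⟩
    filter_upwards [hV.mem_nhds hy₀, hloc y₀ hy₀ hy₀eq] with y hy hyeq
    exact ⟨hy, hyeq⟩
  have hBopen : IsOpen B :=
    (hu₀.continuousOn.sub hu₁.continuousOn).isOpen_inter_preimage hV isOpen_Ioi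
  have hcover : V ⊆ A ∪ B := fun y hy ↦
    (hle y hy).lt_or_eq.elim (fun hlt ↦ Or.inr ⟨hy, sub_pos.mpr hlt⟩) (fun heq ↦ Or.inl ⟨hy, heq⟩)
  have hdisj : Disjoint A B :=
    Set.disjoint_left.mpr fun y h1 h2 ↦ (sub_pos.mp h2.2).ne h1.2
  have hne : (V ∩ A).Nonempty := by
    obtain ⟨y, hy, hyeq⟩ := htouch
    exact ⟨y, hy, hy, hyeq⟩
  have hVA : V ⊆ A := hVconn.subset_left_of_subset_union hAopen hBopen hdisj hcover hne
  exact fun y hy ↦ ((hVA hy).2).symm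

/-! ### Consequences through the existing chain -/

/-- **The barrier principle for minimal surfaces** from the minimal-graph operators with the
tangency maximum principle: `minimalSurface_barrierPrinciple_of_graph` with
`minimalGraph_strongMaximumPrinciple_of_graphOperator` and the discharged
`touchingSurface_locallyGraph_holds`. [cite: AnderssonGallowayHoward1998, Thm. 3.10] -/
theorem minimalSurface_barrierPrinciple_of_graphOperator
    (H : ∀ (X : Type) [TopologicalSpace X] [ChartedSpace E3 X] [IsManifold (𝓡 3) ∞ X] [T2Space X]
      [SecondCountableTopology X]
      (h : ContMDiffRiemannianMetric (𝓡 3) ∞ E3 (TangentSpace (𝓡 3) : X → Type _))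
      [(ofRiemannian h).HasLeviCivita]
      (ψ : OpenPartialHomeomorph X E3) (T : E3 ≃L[ℝ] EuclideanSpace ℝ (Fin 2) × ℝ),
      ψ ∈ IsManifold.maximalAtlas (𝓡 3) ∞ X →
      ∃ G : MinimalGraphOperator h ψ T, HasTangencyMaximumPrinciple G.Φ (chartJetSet ψ T)) :
    minimalSurface_barrierPrinciple :=
  minimalSurface_barrierPrinciple_of_graph (minimalGraph_strongMaximumPrinciple_of_graphOperator H)
    touchingSurface_locallyGraph_holds

/-- **gr.S09, connected horizon**, from Huisken–Ilmanen's two facts and the minimal-graph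
operators with the tangency maximum principle:
`riemannian_penrose_inequality_connected_smooth_of_graph` with
`minimalGraph_strongMaximumPrinciple_of_graphOperator` and `touchingSurface_locallyGraph_holds`.
[cite: HuiskenIlmanenIMCF2001, Main Theorem, Lemma 4.1 and §8 step 1] -/
theorem riemannian_penrose_inequality_connected_smooth_of_graphOperator
    (h1 : exteriorRegion_structure) (h2 : riemannian_penrose_inequality_exteriorRegion)
    (H : ∀ (X : Type) [TopologicalSpace X] [ChartedSpace E3 X] [IsManifold (𝓡 3) ∞ X] [T2Space X]
      [SecondCountableTopology X]
      (h : ContMDiffRiemannianMetric (𝓡 3) ∞ E3 (TangentSpace (𝓡 3) : X → Type _))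
      [(ofRiemannian h).HasLeviCivita]
      (ψ : OpenPartialHomeomorph X E3) (T : E3 ≃L[ℝ] EuclideanSpace ℝ (Fin 2) × ℝ),
      ψ ∈ IsManifold.maximalAtlas (𝓡 3) ∞ X →
      ∃ G : MinimalGraphOperator h ψ T, HasTangencyMaximumPrinciple G.Φ (chartJetSet ψ T)) :
    riemannian_penrose_inequality_connected_smooth :=
  riemannian_penrose_inequality_connected_smooth_of_graph h1 h2
    (minimalGraph_strongMaximumPrinciple_of_graphOperator H) touchingSurface_locallyGraph_holds

end Literature.Geometry.Lorentzian

end
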